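import Literature.MathematicalPhysics.QuantumFieldTheory.Balaban1983to89.HiggsDoubleRTRescale
import Literature.MathematicalPhysics.QuantumFieldTheory.Balaban1983to89.B1Eq231Rescale

/-!
# `Balaban1983to89.B2Eq253StepIntegral` — T. Bałaban, *(Higgs)₂,₃ quantum fields in a finite volume. II. An upper bound*,
Commun. Math. Phys. **86** (1982) 555–594 [Balaban1982Higgs2], Sect. 2.C p. 569, display **(2.53)** (and the recall
(2.54)): the `(k+1)`-st step integral — the renormalization transformation `T^{L^kε}_{a,L}[T^{L^kε}_{a,L,θ_kA^{(k),ε}}[·]]`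
applied to the expression under the integral of (2.43), rescaled from the `L^kε`-lattice to the unit lattice — AS
DISPLAYED, over the concrete (Higgs)₂,₃ carriers `…HiggsLattice` / `…HiggsAveraging` / `…HiggsDoubleRT` /
`…B1Eq230FluctCov` / `…B2Eq255Concrete`, with the two computations the page performs (the action of the double
transformation on the (2.43) summand; the rescaling to the unit lattice) PROVED and print's *"Omitting the numerical
factors"* realised as an explicit constant

statement-level skeleton of published theorems with citation tags; proofs where landed; nothing here is a claim about the Yang–Mills mass gap

PDF held: `paper:balaban1982-cmp86-higgs23-ii` (journal page = PDF page + 554); pp. 566–569 [PDF 12–15] read AS IMAGES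
on the ×2 renders `run/shared/lean/pub/pub-balaban/b2b-balaban-ref1/pages/1982-cmp86-higgs23-II/1982-cmp86-higgs23-II-p012-x2.png`
… `-p015-x2.png`, never from the OCR layer (which garbles every display of these pages).

CITATION HEADER (lean-in-tree rule).  lit-balaban typed skeleton (HOME `run/shared/lean/pub/lit-balaban/`), reader/typer
and fold-owner line r02 (unit `lit-balaban-r02`, gen 51); SKELETON row **B2.Eq2.55** ((2.53)–(2.56), owner r02, second
reader r14): members of record before this file — (2.55) `B2Eq255Concrete.Restr255`/`Restr255Printed`/`barA`/`chi255`
(typer g4 p250795), (2.56) `B2Eq255Concrete.bgScalar256`, the p. 570 regions `B2Eq255RegionsWindow` (p268512) /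
`B2Eq243RegionsTower` (p269146); the owner's READING-RULE AUDIT (`HOME/lit-balaban-r02/READING-RULE-AUDIT-B2-g50.md` §6)
found (a) failing for (2.53) only: *"the renormalization transformation, the one-step conditional integration and every
factor exist in the tree, the DISPLAY (2.53) is not assembled"* and named the owed member `B2Eq253StepIntegral` — THIS
FILE.  Related rows: **B2.Eq2.43** ((2.43), `B2Sect2Statements.Run243`), **B2.Eq2.44** ((2.44)–(2.52): (2.49)/(2.50)
`B2Sect2BDensities.rho249`/`Local250` in schematic coordinates, r14 g4 p248067), **B2.Eq2.1** (the first-step analogue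
(2.1) = I (3.7), `B2Eq21FirstStep.display21`/`doubleRT_exp_neg_action`/`doubleRT_rescale`, typer g2 p244237 — the
PRECEDENT this file follows one level up), **B1.Eq3.37-3.38** (`HiggsDoubleRTRescale`, `HiggsBackgroundRescale`).

THE SOURCE TEXT, p. 569 [PDF 15], verbatim: *"C. A Renormalization Transformation in a General Case (k+1 Step). We apply
the renormalization transformation T^{L^kε}_{a,L}[T^{L^kε}_{a,L,θ_kA^{(k),ε}}[·]] to the expression under the integral on
the right side of (2.43). We get an expression dependent on the new fields B, ψ and its integral over these fields is
≧ Z^ε. Now we will estimate this expression from above. At first we rescale it from the L^kε-lattice T^{(k)}_{L^kε} to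
1-lattice T^{(k)}_1. Omitting the numerical factors, we get the integral
Σ_{Λ₀^{(0)},…,Λ₀^{(k−1)}} ∫dA∫dφ exp[−½aL^{d−2} Σ_{y∈T^{(k)′}} |B(y) − (QA)(y)|² − ½aL^{d−2} Σ_{y∈T^{(k)′}}
|ψ(y) − (Q(θ_kA^{(k)})φ)(y)|²] · ρ′^{(k)}(Λ₀^{(0)},…,Λ₀^{(k−1)}, Λ₇^{(k−1)′c}A, θ_kA^{(k)}, Λ₇^{(k−1)′c}φ)
· exp[−½⟨Λ₆^{(k−1)′}A, Δ^{(k)}Λ₆^{(k−1)′}A⟩ − ½⟨Λ₆^{(k−1)′}φ, Δ^{(k)}(B^k(Λ₂^{(k−1)′}), A^{(k)})Λ₆^{(k−1)′}φ⟩]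
· exp 𝒫^{(k)}(Λ₇^{(k−1)′}, θ_kA^{(k)}, φ). (2.53) Let us recall the formula for A^{(k)} after the rescaling
A^{(k)} = a_kζ^{(k)}G_kQ^*_kA, (2.54)"*.  The expression under the integral of (2.43) p. 566 is, verbatim,
*"Σ_{Λ₀^{(k−1)}⊂T₁^{(k−1)}, admissible} … Σ_{Λ₀^{(0)}⊂T₁, admissible} ρ^{(k),L^kε}(Λ₀^{(0)},…,Λ₀^{(k−1)}, A, θ_kA^{(k),ε}, φ)
· exp(𝒫^{(k),L^kε}(Λ₇^{(k−1)′}, θ_kA^{(k),ε}, φ) − E₀ + Σ_{j=0}^{k−1} O((L^jε)^{κ₀})|Λ₇^{(j−1)′}∩Λ₇^{(j)c}|)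
· exp(Σ_{j=0}^{k−1} O((L^jε)^κ)|T₁^{(j)}|)"*, with (p. 568) *"ρ^{(k),L^kε}(…, A, θ_kA^{(k),ε}, φ) = ρ′^{(k),L^kε}(…, A,
θ_kA^{(k),ε}, φ)·exp[−½⟨Λ₆^{(k−1)′}A, Δ^{(k),L^kε}Λ₆^{(k−1)′}A⟩ − ½⟨Λ₆^{(k−1)′}φ, Δ^{(k),L^kε}(B^k(Λ₂^{(k−1)′}),
A^{(k),ε})Λ₆^{(k−1)′}φ⟩], (2.49)"*, *"ρ′^{(k),L^kε}(…, A, θ_kA^{(k),ε}, φ) = ρ′^{(k),L^kε}(…, Λ₇^{(k−1)′c}A, θ_kA^{(k),ε},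
Λ₇^{(k−1)′c}φ). (2.50) Here we treat θ_kA^{(k)} as an independent field configuration appearing only as an external vector
field in the expressions with scalar fields"*, and (p. 568) *"and similarly for the form ⟨A, Δ^{(k),L^kε}_{Λ₅^{(k−1)}}A⟩,
except that Neumann boundary conditions are not introduced"*; p. 569: *"The inductive definitions (2.46)–(2.50) allow us to
write an explicit formula for ρ^{(k),L^kε}(…). We do not do it because we will not need this formula"*; *"A detailed
description of 𝒫^{(k),L^kε}(Λ₇^{(k−1)′}) will be given in a paper on renormalization of perturbation expansions."*

HOW IT IS TYPED (reuse by name; nothing re-declared).  The `L^kε`-lattice family `P` of `HiggsLattice` (level `k` =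
`T^{(k)}_{L^kε}`, level `k+1` = its block lattice `T^{(k)′}`, level `0` = `T_ε`, on which the external fields live), fields
`A : VecField P k`, `φ : ScalarField P k N`, block fields `B : VecField P (k+1)`, `ψ : ScalarField P (k+1) N`; the unit
lattice of (2.53) is the rescaled family `P.scaleBy s` at `s = (L^kε)⁻¹` (`HiggsRescaling`, `B1Eq338Rescaling.unitScale`),
on which `mesh_k = 1` and the precision `a(L·mesh_k)^{d−2}` of the kernels (I.2.6) (`B1RT.prec`) reads `aL^{d−2}`
(`stepExponent_unit`).  The double transformation `T^{L^kε}_{a,L}[T^{L^kε}_{a,L,Ã(A)}[·]]` = `HiggsDoubleRT.doubleRTk C a ext`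
at the external-field assignment `ext : A ↦ θ_kA^{(k),ε}` (typed as the pointwise product `thetaMul θ bg` of a site
function `θ` — print's `θ_k`, the tree's `B2Eq245Theta.thetaOf` — with an assignment `bg : A ↦ A^{(k),ε}`, (2.44)/(2.54);
both enter the theorems as PARAMETERS, `bg` also un-multiplied inside `Δ^{(k)}(B^k(Λ₂′), A^{(k)})` as printed).  The printed
letters of (2.53): `Σ_y|B(y) − (QA)(y)|²` = `‖toSite B y − linAvg (toSite A) y‖²` (the vector field as the `ℝ^d`-valued
site function, I p. 608 *"N = d, A = 0"*, `B3MultiscaleFields.toSite`, `B2Eq21FirstStep.linAvg`), `(Q(θ_kA^{(k)})φ)(y)` =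
`HiggsAveraging.avgQ C (ext A) φ y` ((I.2.7)); the cuts `Λ₇^{(k−1)′c}φ`, `Λ₆^{(k−1)′}φ` = `B2Eq255Concrete.cutTo` (I p. 608
*"We will identify a set Λ with the characteristic function defined by the set, thus we will write Λf and it means the
product of the characteristic function Λ and the function f"*) and `cutVec` for the vector field (= `cutTo` of its site
function, `toSite_cutVec`); **the two basic quadratic forms of (2.49)/(2.53) are
CONCRETE**: `⟨Λ₆′A, Δ^{(k)}Λ₆′A⟩` = `siteInner` ((I.1.5)) of the cut site function against p35's
`B1Eq230FluctCov.deltaKA (zeroCharge d) univ 0 μ² a k` — (I.2.21) for the VECTOR field, I p. 608 *"N = d and an external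
vector field A = 0"*, on the whole lattice (*"Neumann boundary conditions are not introduced"*), = the typer's
`HiggsFluctMeasure.deltaK` (`gaussVec_eq_deltaK`) —, and `⟨Λ₆′φ, Δ^{(k)}(B^k(Λ₂′), A^{(k)})Λ₆′φ⟩` = `siteInner` against
`deltaKA C Ω (bg A) m² a k`, `Ω` ↤ `B^k(Λ₂^{(k−1)′})` = `B2Eq255Concrete.underRegion k Λ₂′` ((I.2.21) with Neumann
conditions on `B^k(Λ₂^{(k−1)′})` in the background `A^{(k)}`).  What print leaves undisplayed enters as parameters,
bundled per admissible sequence `(Λ₀^{(0)},…,Λ₀^{(k−1)})` in `SeqData`: the regions `B^k(Λ₂^{(k−1)′})`, `Λ₆^{(k−1)′}`,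
`Λ₇^{(k−1)′}` of the sequence (concretely the typer's `B2Eq243RegionsTower.towerRegion` and `B2Eq255Concrete.underRegion`,
not needed here), the density `ρ′^{(k)}` (*"We do not [write an explicit formula] because we will not need this formula"*)
as a function of (external field, `A`, `φ`), `𝒫^{(k)}(Λ₇^{(k−1)′}, ·, ·)` (*"will be given in a paper on renormalization
of perturbation expansions"*), and the sequence's numerical factor
`exp(−E₀ + Σ_j O(…)|Λ₇^{(j−1)′}∩Λ₇^{(j)c}|)·exp(Σ_j O(…)|T₁^{(j)}|)` of (2.43) (`w`); the sum over admissible sequences is a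
`Finset.sum` over an index type (r02's `B2Sect2Statements.Run243.Seq`).  The (2.43) summand is typed WITH (2.49) AND (2.50)
SUBSTITUTED (`summand243`; `summand243_eq_rho249` records that this is `ρ^{(k)}·exp(𝒫 …)·w` for `ρ^{(k)} = ρ′^{(k)}·[basic
Gaussian factor on Λ₆′]` (2.49) whenever `ρ′^{(k)}` has the locality (2.50), `IsLocal250`).

WHAT IS PROVED (kernel-checked, 0 `sorry`, standard axioms; every definition has a body; no `Prop` fact).
 §1 `cutVec`, `toSite_cutVec`, `cutVec_univ`; §2 `gaussVec`/`gaussScalar`/`gauss249` (the (2.49) factor), `gauss249_pos`,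
    `gaussVec_eq_deltaK`; §3 `SeqData`, `thetaMul`, `summand243`, `IsLocal250`, `rho249C`, `summand243_eq_rho249`;
 §4 (2.53): `stepExponent` (the bracket of the two transformation kernels), **`stepIntegrand253`** (the five printed factors
    in print's order), **`display253`** (`Σ_s ∫dA∫dφ …`, LITERALLY the display, to be read on the unit-lattice family),
    `stepExponent_unit` (`mesh_k = 1` ⇒ the precision is `aL^{d−2}` as printed), `stepKernelConst` (= the product of the two
    kernel normalisations `HiggsDoubleRT.kernelBound`);
 §5 `vecKernel_eq_const_mul_exp`, `rtKernelStep_eq_const_mul_exp` (each kernel (I.2.5)–(I.2.6) is a constant times the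
    exponential of its Gaussian term), **`doubleRTk_summand243`**: on ANY lattice of the family,
    `T_{a,L}[T_{a,L,θ_kA^{(k)}}[summand_s]](B, ψ) = stepKernelConst · w_s · ∫dA∫dφ stepIntegrand253_s(B, ψ; A, φ)` — the two
    kernels contribute exactly the bracket of (2.53) and constants (pointwise algebra + linearity of the integral; no
    convergence statement is used or made; the sum over sequences stays outside, `display253_eq_sum`);
 §6 the rescaling *"from the L^kε-lattice to 1-lattice"*: `rescaleVec_zero`, `zeroCharge_scaleBy`, `cutVec_rescaleVec`,
    `siteInner_rescaleScalar` (`⟨σf′, σg′⟩_ε = s⁻²⟨f′, g′⟩_{sε}`), `quadForm_deltaKA_rescale` (the basic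
    quadratic form `⟨u, Δ^{(k),L^kε}(Ω, Ã)u⟩` is INVARIANT under the canonical rescaling (1.22) with `m² ↦ m²s⁻²`, from r14's
    `B1Eq231Rescale.deltaKA_rescale`), `gauss249_rescale`, `thetaMul_rescale`, `SeqData.rescale` (the pulled-back `ρ′`, `𝒫` —
    print's dropping of the superscript `L^kε`), **`summand243_rescale`**, and **`doubleRTk_summand243_rescale`**:
    `T^{L^kε}T^{L^kε}_{θ_kA^{(k),ε}}[summand_s](σB′, σψ′) = (rescaleFactor · stepKernelConst · w_s) · ∫dA′∫dφ′
    stepIntegrand253_s′(B′, ψ′; A′, φ′)` over the fields of the rescaled family — at `s = (L^kε)⁻¹` (`unit_mesh_k`) the right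
    side is the `s`-th term of (2.53) with its omitted numerical factor EXPLICIT (`doubleRTk_summand243_unit`); and
    `doubleRTk_summand243_rescale_bgVec`: print's instance up to the cut-off — `A^{(k),ε}` := the (I.3.29) field
    `B1Eq31Concrete.bgVec` ((2.44) at `ζ ≡ 1`), `θ_kA^{(k)}` := `thetaMul θ bgVec` — with BOTH covariance hypotheses discharged
    (`HiggsBackgroundRescale.bgVec_rescale`, `thetaMul_rescale`);
 and **`display253_eq_sum_doubleRTk`**: on the rescaled family, `display253` (pulled-back data) = Σ_s (numerical
    factor)_s⁻¹ · T·T[summand_s](σB′, σψ′) — (2.53) itself as the image of the (2.43) integrand, factors explicit;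
 §7 (2.54) = r14's (2.44) `B2StepK.bg244` at `ℓ = 1`: `eq254`.
HONEST SCOPE.  (a) `ρ′^{(k)}`, `𝒫^{(k)}`, the regions of a sequence and the assignment `A ↦ A^{(k)}` are parameters (print
gives no closed form for the first two, the regions are (2.8)′ and the background is (2.44)); the covariance of `A ↦ A^{(k),ε}` under the
rescaling is the hypothesis `hbg` of §6 (for the cut-off-free (I.3.29) field it is the typer's
`HiggsBackgroundRescale.bgVec_rescale`; with the cut-off `ζ^{(k)}` of (2.44) it is not in the tree).  (b) `m² > 0`, `μ₀² > 0`,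
`a > 0`, `L > 1` in §6 (the hypotheses of `deltaKA_rescale`).  (c) The finite sum over sequences is carried OUTSIDE the
double transformation term by term (`doubleRTk_summand243` is per sequence); exchanging `T·T` with `Σ_s` needs the
integrability of each summand against the kernels and is not asserted.  (d) Nothing quantitative: no estimate of Sect. 2.C
((2.57) ff.) is touched; convergence of the integrals is not part of the display.  Value = the typed display (2.53) with
its provenance from (2.43) kernel-checked; NOT summit progress.
-/

open scoped BigOperators Matrix
open _root_.MeasureTheory _root_.Real

namespace Literature.MathematicalPhysics.QuantumFieldTheory.Balaban1983to89.B2Eq253StepIntegral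

open Literature.MathematicalPhysics.QuantumFieldTheory.Balaban1983to89.HiggsLattice
open Literature.MathematicalPhysics.QuantumFieldTheory.Balaban1983to89.HiggsAveraging
open Literature.MathematicalPhysics.QuantumFieldTheory.Balaban1983to89.HiggsRescaling
open Literature.MathematicalPhysics.QuantumFieldTheory.Balaban1983to89.HiggsDoubleRT
open Literature.MathematicalPhysics.QuantumFieldTheory.Balaban1983to89.HiggsDoubleRTRescale
open Literature.MathematicalPhysics.QuantumFieldTheory.Balaban1983to89.B2Eq21FirstStep
  (linAvg avgQ_zero blockKernel_eq_const_mul_exp toSite_rescaleVec linAvg_rescaleScalar)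
open Literature.MathematicalPhysics.QuantumFieldTheory.Balaban1983to89.B3MultiscaleFields (toSite zeroCharge)
open Literature.MathematicalPhysics.QuantumFieldTheory.Balaban1983to89.B2Eq255Concrete (cutTo underRegion)
open Literature.MathematicalPhysics.QuantumFieldTheory.Balaban1983to89.B1Eq230FluctCov (deltaKA deltaKA_zero_field)
open Literature.MathematicalPhysics.QuantumFieldTheory.Balaban1983to89.B1Eq231Rescale
  (deltaKA_rescale cutTo_rescaleScalar level_cases)
open Literature.MathematicalPhysics.QuantumFieldTheory.Balaban1983to89.HiggsBackgroundRescale (rescaleScalar_smul)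
open Literature.MathematicalPhysics.QuantumFieldTheory.Balaban1983to89.HiggsFluctMeasurePos (siteInner_smul_right)

variable {P : HiggsLattice.Params} {N k : ℕ}

/-! ## 1. `Λ A` for the vector field: the cut of a bond function to a region of sites -/

section Cut

/-- `Λ A` for a VECTOR field (I p. 608: *"thus we will write Λf and it means the product of the characteristic function Λ
and the function f"*; in (2.50)/(2.53) `Λ₇^{(k−1)′c}A`, in (2.49)/(2.53) `Λ₆^{(k−1)′}A`): the vector field regarded as the
`ℝ^d`-valued site function `x ↦ (A_μ(x))_μ` (I p. 608) multiplied by the characteristic function of `Λ`, i.e. the bond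
function kept on the bonds `⟨x, x + e_μ⟩` with `x ∈ Λ` and set to `0` elsewhere. [cite: Balaban1982Higgs2, (2.50) p.568] -/
noncomputable def cutVec (Λ : Finset (HiggsLattice.Site P k)) (A : HiggsLattice.VecField P k) : HiggsLattice.VecField P k :=
  fun b => if b.src ∈ Λ then A b else 0

/-- Unfolding of `cutVec`. [cite: Balaban1982Higgs2, (2.50) p.568] -/
theorem cutVec_apply (Λ : Finset (HiggsLattice.Site P k)) (A : HiggsLattice.VecField P k) (b : HiggsLattice.PBond P k) :
    cutVec Λ A b = if b.src ∈ Λ then A b else 0 := rfl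

/-- The vector cut IS the scalar cut `B2Eq255Concrete.cutTo` of the `ℝ^d`-valued site function: `(ΛA)_μ(x) = (Λ·(A_ν(·))_ν)(x)_μ`.
[cite: Balaban1982Higgs2, (2.50) p.568] -/
theorem toSite_cutVec (Λ : Finset (HiggsLattice.Site P k)) (A : HiggsLattice.VecField P k) :
    toSite (cutVec Λ A) = cutTo Λ (toSite A) := by
  funext x
  by_cases hx : x ∈ Λ
  · rw [B2Eq255Concrete.cutTo_of_mem Λ _ hx]
    ext μ
    simp [toSite, cutVec, hx]
  · rw [B2Eq255Concrete.cutTo_of_not_mem Λ _ hx]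
    ext μ
    simp [toSite, cutVec, hx]

/-- The cut to the whole lattice is the identity. [cite: Balaban1982Higgs2, (2.50) p.568] -/
theorem cutVec_univ (A : HiggsLattice.VecField P k) : cutVec Finset.univ A = A := by
  funext b
  simp [cutVec]

end Cut

/-! ## 2. The basic Gaussian factor of (2.49) / (2.53), CONCRETE -/

section Gauss

/-- `⟨Λ₆′A, Δ^{(k)}Λ₆′A⟩` — the VECTOR-field basic quadratic form of (2.49)/(2.53): the scalar product (I.1.5)
(`HiggsLattice.siteInner`, weight `(mesh_k)^d`) of the cut site function `Λ₆′(A_μ(·))_μ` against (I.2.21)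
`Δ^{(k),L^kε}` for the vector field — I p. 608 *"taking N = d and an external vector field A = 0"*: p35's
`B1Eq230FluctCov.deltaKA` at the trivial coupling `zeroCharge d`, the zero field and `Ω` = the whole lattice (p. 568:
*"similarly for the form ⟨A, Δ^{(k),L^kε}A⟩, except that Neumann boundary conditions are not introduced"*), vector mass
`musq` (↤ `μ₀²` on the `L^kε`-lattice, `μ₀²(L^kε)²` on the unit lattice). [cite: Balaban1982Higgs2, (2.49) p.568, (2.53) p.569] -/
noncomputable def gaussVec (musq a : ℝ) (k : ℕ) (Λ₆ : Finset (HiggsLattice.Site P k)) (A : HiggsLattice.VecField P k) : ℝ :=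
  siteInner (cutTo Λ₆ (toSite A))
    (deltaKA (zeroCharge P.d) Finset.univ (0 : HiggsLattice.VecField P 0) musq a k (cutTo Λ₆ (toSite A)))

/-- `⟨Λ₆′φ, Δ^{(k)}(B^k(Λ₂′), A^{(k)})Λ₆′φ⟩` — the SCALAR-field basic quadratic form of (2.49)/(2.53): `siteInner` of the cut
field `Λ₆′φ` against (I.2.21) `Δ^{(k),L^kε}(Ω, Ã)` (`B1Eq230FluctCov.deltaKA`) with Neumann conditions on the fine-lattice
region `Ω` ↤ `B^k(Λ₂^{(k−1)′})` (for the sequence's `Λ₂^{(k−1)′} ⊂ T^{(k)}`: `B2Eq255Concrete.underRegion k Λ₂′`) in the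
background `Ã = A^{(k)}` (`Ak`, a field on the finest lattice), scalar mass `msq` (↤ `m²` resp. `m²(L^kε)²`).
[cite: Balaban1982Higgs2, (2.49) p.568, (2.53) p.569] -/
noncomputable def gaussScalar (C : ChargeData N) (msq a : ℝ) (k : ℕ) (Ω : Finset (HiggsLattice.Site P 0))
    (Λ₆ : Finset (HiggsLattice.Site P k)) (Ak : HiggsLattice.VecField P 0) (φ : ScalarField P k N) : ℝ :=
  siteInner (cutTo Λ₆ φ) (deltaKA C Ω Ak msq a k (cutTo Λ₆ φ))

/-- **The basic Gaussian factor of (2.49) / lines 4–5 of (2.53)**, verbatim: *"exp[−½⟨Λ₆^{(k−1)′}A, Δ^{(k)}Λ₆^{(k−1)′}A⟩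
− ½⟨Λ₆^{(k−1)′}φ, Δ^{(k)}(B^k(Λ₂^{(k−1)′}), A^{(k)})Λ₆^{(k−1)′}φ⟩]"* (on the `L^kε`-lattice with the superscripts `L^kε`, `ε`
of (2.49); on the unit lattice as in (2.53) — the same term read on the rescaled family, `gauss249_rescale`).
[cite: Balaban1982Higgs2, (2.49) p.568, (2.53) p.569] -/
noncomputable def gauss249 (C : ChargeData N) (musq msq a : ℝ) (k : ℕ) (Ω : Finset (HiggsLattice.Site P 0))
    (Λ₆ : Finset (HiggsLattice.Site P k)) (Ak : HiggsLattice.VecField P 0) (A : HiggsLattice.VecField P k)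
    (φ : ScalarField P k N) : ℝ :=
  Real.exp (-(1 / 2 : ℝ) * gaussVec musq a k Λ₆ A - (1 / 2 : ℝ) * gaussScalar C msq a k Ω Λ₆ Ak φ)

/-- The basic Gaussian factor is positive (so (2.49) determines `ρ′^{(k)}` from `ρ^{(k)}`, cf. r14's
`B2Sect2BDensities.eq249`). [cite: Balaban1982Higgs2, (2.49) p.568] -/
theorem gauss249_pos (C : ChargeData N) (musq msq a : ℝ) (k : ℕ) (Ω : Finset (HiggsLattice.Site P 0))
    (Λ₆ : Finset (HiggsLattice.Site P k)) (Ak : HiggsLattice.VecField P 0) (A : HiggsLattice.VecField P k)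
    (φ : ScalarField P k N) : 0 < gauss249 C musq msq a k Ω Λ₆ Ak A φ :=
  Real.exp_pos _

/-- DICTIONARY: the vector-field operator inside `gaussVec` IS the typer's `HiggsFluctMeasure.deltaK` — (I.2.21) *"at N = d,
external field A = 0"* (`B1Eq230FluctCov.deltaKA_zero_field`). [cite: Balaban1982Higgs1, (2.21) p.610] -/
theorem gaussVec_eq_deltaK (musq a : ℝ) (k : ℕ) (Λ₆ : Finset (HiggsLattice.Site P k)) (A : HiggsLattice.VecField P k) :
    gaussVec musq a k Λ₆ A
      = siteInner (cutTo Λ₆ (toSite A)) (HiggsFluctMeasure.deltaK P musq a k (cutTo Λ₆ (toSite A))) := by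
  rw [gaussVec, deltaKA_zero_field]

end Gauss

/-! ## 3. One admissible sequence: its data, the external field `θ_kA^{(k)}`, and the (2.43) summand with (2.49)–(2.50) substituted -/

section Summand

variable (P N k) in
/-- The data print attaches to ONE admissible sequence `(Λ₀^{(0)}, …, Λ₀^{(k−1)})` of (2.43) p. 566 (*"Here the word
“admissible” means that the sets Λ₀^{(j)} have to satisfy all the conditions resulting from the construction"*) and that
(2.53) displays: the regions `B^k(Λ₂^{(k−1)′}) ⊂ T_η` and `Λ₆^{(k−1)′}, Λ₇^{(k−1)′} ⊂ T^{(k)}` of the sequence ((2.8)′ at the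
last level; concretely the typer's `B2Eq243RegionsTower` / `B2Eq255Concrete.underRegion`), the density
`ρ′^{(k)}(Λ₀^{(0)},…,Λ₀^{(k−1)}, A, θ_kA^{(k)}, φ)` of (2.49)–(2.50) as a function `rhoP A E φ` of the vector field, the external field `E = θ_kA^{(k)}` (p. 568: *"an independent
field configuration"*) and the scalar field, in print's order — print writes no closed form for it (p. 569: *"We do not do
it because we will not need this formula"*) —, the term `𝒫^{(k)}(Λ₇^{(k−1)′}, θ_kA^{(k)}, φ)` as a function `calP E φ` (p. 569:
*"A detailed description of 𝒫^{(k),L^kε}(Λ₇^{(k−1)′}) will be given in a paper on renormalization of perturbation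
expansions"*), and the sequence's numerical factor `w` ↤ `exp(−E₀ + Σ_{j<k} O((L^jε)^{κ₀})|Λ₇^{(j−1)′}∩Λ₇^{(j)c}|) ·
exp(Σ_{j<k} O((L^jε)^κ)|T₁^{(j)}|)` of (2.43) (among the *"numerical factors"* (2.53) omits). [cite: Balaban1982Higgs2, (2.43) p.566, (2.53) p.569] -/
structure SeqData where
  /-- `B^k(Λ₂^{(k−1)′}) ⊂ T_η`, the Neumann region of `Δ^{(k)}(·, A^{(k)})` — the fine-lattice region under the sequence's
  `Λ₂^{(k−1)′} ⊂ T^{(k)}` (`B2Eq255Concrete.underRegion k Λ₂′`). [cite: Balaban1982Higgs2, (2.53) p.569] -/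
  B2 : Finset (HiggsLattice.Site P 0)
  /-- `Λ₆^{(k−1)′} ⊂ T^{(k)}` (the region of the basic Gaussian factor (2.49)). [cite: Balaban1982Higgs2, (2.49) p.568] -/
  R6 : Finset (HiggsLattice.Site P k)
  /-- `Λ₇^{(k−1)′} ⊂ T^{(k)}` (outside it — on `Λ₇^{(k−1)′c}` — the density `ρ′^{(k)}` lives, (2.50)). [cite: Balaban1982Higgs2, (2.50) p.568] -/
  R7 : Finset (HiggsLattice.Site P k)
  /-- `ρ′^{(k)}(Λ₀^{(0)},…,Λ₀^{(k−1)}, A, E, φ)` as a function of `(A, E, φ)`, `E` ↤ `θ_kA^{(k)}` on the finest lattice.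
  [cite: Balaban1982Higgs2, (2.50) p.568] -/
  rhoP : HiggsLattice.VecField P k → HiggsLattice.VecField P 0 → ScalarField P k N → ℝ
  /-- `𝒫^{(k)}(Λ₇^{(k−1)′}, E, φ)` as a function of `(E, φ)`. [cite: Balaban1982Higgs2, (2.43) p.566] -/
  calP : HiggsLattice.VecField P 0 → ScalarField P k N → ℝ
  /-- the numerical factor of the sequence's term in (2.43). [cite: Balaban1982Higgs2, (2.43) p.566] -/
  w : ℝ

/-- **`θ_kA^{(k)}`** (p. 566–567: *"The function θ_k is defined on T_η, is equal to 1 on B^{k−1}(Λ₂^{(k−1)}) and varies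
“smoothly” from 1 to 0 on a slice of thickness < M … These functions are rescaled in (2.44)"*; concretely the typer's
`B2Eq245Theta.thetaOf`, a site function on the finest lattice): the external-field assignment `A ↦ θ_k · A^{(k)}[A]` —
the site function `θ` times the background field `bg A = A^{(k)}` ((2.44)/(2.54)), componentwise:
`(θ_kA^{(k)})_μ(x) = θ_k(x)·A^{(k)}_μ(x)`. [cite: Balaban1982Higgs2, (2.44) p.566, (2.53) p.569] -/
def thetaMul (θ : HiggsLattice.Site P 0 → ℝ) (bg : HiggsLattice.VecField P k → HiggsLattice.VecField P 0) : HiggsLattice.VecField P k → HiggsLattice.VecField P 0 :=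
  fun A b => θ b.src * bg A b

/-- Unfolding of `thetaMul`. [cite: Balaban1982Higgs2, (2.53) p.569] -/
theorem thetaMul_apply (θ : HiggsLattice.Site P 0 → ℝ) (bg : HiggsLattice.VecField P k → HiggsLattice.VecField P 0) (A : HiggsLattice.VecField P k) (b : HiggsLattice.PBond P 0) :
    thetaMul θ bg A b = θ b.src * bg A b := rfl

/-- **The term of ONE admissible sequence in the expression under the integral of (2.43) p. 566, with (2.49) and (2.50)
substituted**: `ρ^{(k),L^kε}(Λ's, A, θ_kA^{(k),ε}, φ) · exp(𝒫^{(k),L^kε}(Λ₇^{(k−1)′}, θ_kA^{(k),ε}, φ) − E₀ + Σ_j O(…)) ·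
exp(Σ_j O(…))` = `w · ρ′^{(k)}(Λ's, Λ₇′ᶜA, θ_kA^{(k)}, Λ₇′ᶜφ) · exp[−½⟨Λ₆′A, Δ^{(k)}Λ₆′A⟩ − ½⟨Λ₆′φ, Δ^{(k)}(B^k(Λ₂′),
A^{(k)})Λ₆′φ⟩] · exp 𝒫^{(k)}(Λ₇′, θ_kA^{(k)}, φ)` — by (2.49) `ρ = ρ′·[basic Gaussian factor on Λ₆′]` and by (2.50)
`ρ′(…, A, ·, φ) = ρ′(…, Λ₇′ᶜA, ·, Λ₇′ᶜφ)`.  `bg` ↤ `A ↦ A^{(k),ε}` ((2.44)), `ext` ↤ `A ↦ θ_kA^{(k),ε}` (print's instance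
`thetaMul θ bg`), `musq`/`msq` ↤ `μ₀²`/`m²`. [cite: Balaban1982Higgs2, (2.43) p.566, (2.49)–(2.50) p.568] -/
noncomputable def summand243 (C : ChargeData N) (musq msq a : ℝ) (k : ℕ) (bg ext : HiggsLattice.VecField P k → HiggsLattice.VecField P 0)
    (S : SeqData P N k) (A : HiggsLattice.VecField P k) (φ : ScalarField P k N) : ℝ :=
  S.w * (S.rhoP (cutVec S.R7ᶜ A) (ext A) (cutTo S.R7ᶜ φ) * gauss249 C musq msq a k S.B2 S.R6 (bg A) A φ
    * Real.exp (S.calP (ext A) φ))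

/-- **(2.50)** p. 568 for a density on the concrete fields: `ρ′(…, A, E, φ) = ρ′(…, Λ₇^{(k−1)′c}A, E, Λ₇^{(k−1)′c}φ)` —
`ρ′` depends on `A`, `φ` only through their cuts to `Λ₇^{(k−1)′c}` (r14's schematic `B2Sect2BDensities.Local250` on the
carrier). [cite: Balaban1982Higgs2, (2.50) p.568] -/
def IsLocal250 (Λ₇ : Finset (HiggsLattice.Site P k))
    (ρ' : HiggsLattice.VecField P k → HiggsLattice.VecField P 0 → ScalarField P k N → ℝ) : Prop :=
  ∀ A E φ, ρ' A E φ = ρ' (cutVec Λ₇ᶜ A) E (cutTo Λ₇ᶜ φ)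

/-- **(2.49)** p. 568 read left to right on the concrete fields: `ρ^{(k)}(…, A, E, φ) := ρ′^{(k)}(…, A, E, φ) ·
exp[−½⟨Λ₆′A, Δ^{(k)}Λ₆′A⟩ − ½⟨Λ₆′φ, Δ^{(k)}(B^k(Λ₂′), A^{(k)})Λ₆′φ⟩]` (r14's schematic `B2Sect2BDensities.rho249` on the
carrier, the factor being `gauss249`). [cite: Balaban1982Higgs2, (2.49) p.568] -/
noncomputable def rho249C (C : ChargeData N) (musq msq a : ℝ) (k : ℕ) (bg : HiggsLattice.VecField P k → HiggsLattice.VecField P 0)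
    (S : SeqData P N k) (A : HiggsLattice.VecField P k) (E : HiggsLattice.VecField P 0) (φ : ScalarField P k N) : ℝ :=
  S.rhoP A E φ * gauss249 C musq msq a k S.B2 S.R6 (bg A) A φ

/-- PROVENANCE of `summand243`: for a density `ρ′^{(k)}` with the locality (2.50), the sequence's term of (2.43) —
`ρ^{(k)}(…, A, θ_kA^{(k)}, φ)·exp(𝒫^{(k)}(…))·[numerical factor]` with `ρ^{(k)}` given by (2.49) — IS `summand243`. PROVED
(rewriting). [cite: Balaban1982Higgs2, (2.43) p.566, (2.49)–(2.50) p.568] -/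
theorem summand243_eq_rho249 (C : ChargeData N) (musq msq a : ℝ) (k : ℕ) (bg ext : HiggsLattice.VecField P k → HiggsLattice.VecField P 0)
    (S : SeqData P N k) (hloc : IsLocal250 S.R7 S.rhoP) (A : HiggsLattice.VecField P k) (φ : ScalarField P k N) :
    summand243 C musq msq a k bg ext S A φ
      = rho249C C musq msq a k bg S A (ext A) φ * Real.exp (S.calP (ext A) φ) * S.w := by
  unfold summand243 rho249C
  rw [← hloc A (ext A) φ]
  ring

end Summand

/-! ## 4. The display (2.53) -/

section Display

/-- **The bracket of (2.53), lines 1–2** — the exponent contributed by the kernels (I.2.5)–(I.2.6) of the two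
transformations at level `k`: `−½κ Σ_{y∈T^{(k)′}} |B(y) − (QA)(y)|² − ½κ Σ_{y∈T^{(k)′}} |ψ(y) − (Q(θ_kA^{(k)})φ)(y)|²`,
`κ = a(L·mesh_k)^{d−2}` (`B1RT.prec a (mesh_{k+1}) d`; on the unit lattice `κ = aL^{d−2}` as printed, `stepExponent_unit`),
`QA` the plain block average of the `ℝ^d`-valued site function (`B2Eq21FirstStep.linAvg ∘ toSite`, I p. 608),
`Q(θ_kA^{(k)})φ` the covariant average (I.2.7) `HiggsAveraging.avgQ C (ext A) φ`. [cite: Balaban1982Higgs2, (2.53) p.569] -/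
noncomputable def stepExponent (C : ChargeData N) (a : ℝ) (k : ℕ) (ext : HiggsLattice.VecField P k → HiggsLattice.VecField P 0)
    (B : HiggsLattice.VecField P (k + 1)) (ψ : ScalarField P (k + 1) N) (A : HiggsLattice.VecField P k) (φ : ScalarField P k N) : ℝ :=
  -(B1RT.prec a (P.mesh (k + 1)) P.d / 2) * ∑ y : HiggsLattice.Site P (k + 1), ‖toSite B y - linAvg (toSite A) y‖ ^ 2
    - B1RT.prec a (P.mesh (k + 1)) P.d / 2 * ∑ y : HiggsLattice.Site P (k + 1), ‖ψ y - avgQ C (ext A) φ y‖ ^ 2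

/-- **The integrand of (2.53) for one sequence**, the five printed factors in print's order:
`exp[bracket] · ρ′^{(k)}(Λ's, Λ₇^{(k−1)′c}A, θ_kA^{(k)}, Λ₇^{(k−1)′c}φ) · exp[−½⟨Λ₆′A, Δ^{(k)}Λ₆′A⟩ − ½⟨Λ₆′φ, Δ^{(k)}(B^k(Λ₂′),
A^{(k)})Λ₆′φ⟩] · exp 𝒫^{(k)}(Λ₇′, θ_kA^{(k)}, φ)`. [cite: Balaban1982Higgs2, (2.53) p.569] -/
noncomputable def stepIntegrand253 (C : ChargeData N) (musq msq a : ℝ) (k : ℕ) (bg ext : HiggsLattice.VecField P k → HiggsLattice.VecField P 0)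
    (S : SeqData P N k) (B : HiggsLattice.VecField P (k + 1)) (ψ : ScalarField P (k + 1) N) (A : HiggsLattice.VecField P k)
    (φ : ScalarField P k N) : ℝ :=
  Real.exp (stepExponent C a k ext B ψ A φ)
    * S.rhoP (cutVec S.R7ᶜ A) (ext A) (cutTo S.R7ᶜ φ) * gauss249 C musq msq a k S.B2 S.R6 (bg A) A φ
    * Real.exp (S.calP (ext A) φ)

/-- **(2.53)** p. 569 [PDF 15] AS DISPLAYED (verbatim in the module header): the function of the block fields
`(B, ψ) ↦ Σ_{sequences s} ∫dA ∫dφ stepIntegrand253_s(B, ψ; A, φ)` — the sum over the admissible sequences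
`(Λ₀^{(0)},…,Λ₀^{(k−1)})` (a finite index set `ι`, r02's `B2Sect2Statements.Run243.Seq`) OUTSIDE the two Lebesgue integrals
`dA` (bond functions on `T^{(k)}`), `dφ` (`ℝ^N`-valued site functions), I p. 605; to be read on the unit-lattice family
(`mesh_k = 1`, `stepExponent_unit`; reached from the `L^kε`-family by `doubleRTk_summand243_unit`).  Convergence of the
integrals is not part of the display. [cite: Balaban1982Higgs2, (2.53) p.569] -/
noncomputable def display253 {ι : Type*} (𝓢 : Finset ι) (C : ChargeData N) (musq msq a : ℝ) (k : ℕ)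
    (bg ext : HiggsLattice.VecField P k → HiggsLattice.VecField P 0) (S : ι → SeqData P N k) (B : HiggsLattice.VecField P (k + 1))
    (ψ : ScalarField P (k + 1) N) : ℝ :=
  ∑ s ∈ 𝓢, ∫ A : HiggsLattice.VecField P k, ∫ φ : ScalarField P k N, stepIntegrand253 C musq msq a k bg ext (S s) B ψ A φ

/-- (2.53) is, term by term, the double integral of `stepIntegrand253` (definitional). [cite: Balaban1982Higgs2, (2.53) p.569] -/
theorem display253_eq_sum {ι : Type*} (𝓢 : Finset ι) (C : ChargeData N) (musq msq a : ℝ) (k : ℕ)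
    (bg ext : HiggsLattice.VecField P k → HiggsLattice.VecField P 0) (S : ι → SeqData P N k) (B : HiggsLattice.VecField P (k + 1))
    (ψ : ScalarField P (k + 1) N) :
    display253 𝓢 C musq msq a k bg ext S B ψ
      = ∑ s ∈ 𝓢, ∫ A : HiggsLattice.VecField P k, ∫ φ : ScalarField P k N, stepIntegrand253 C musq msq a k bg ext (S s) B ψ A φ :=
  rfl

/-- The block lattice of a lattice with `mesh_k = 1` has spacing `L` (`B1Eq338Rescaling.mesh_succ`). [cite: Balaban1982Higgs2, (2.53) p.569] -/
theorem mesh_succ_of_unit {P₁ : HiggsLattice.Params} (h1 : P₁.mesh k = 1) : P₁.mesh (k + 1) = P₁.L := by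
  rw [B1Eq338Rescaling.mesh_succ, h1, mul_one]

/-- **On the unit lattice the bracket of (2.53) is LITERALLY the printed one**: when `mesh_k = 1` (the lattice `T^{(k)}_1` of
p. 569, block lattice `T^{(k)′}` of spacing `L`) the precision of both kernels is `aL^{d−2}`:
`bracket = −½aL^{d−2}Σ_y|B(y) − (QA)(y)|² − ½aL^{d−2}Σ_y|ψ(y) − (Q(θ_kA^{(k)})φ)(y)|²`. PROVED. [cite: Balaban1982Higgs2, (2.53) p.569] -/
theorem stepExponent_unit {P₁ : HiggsLattice.Params} (h1 : P₁.mesh k = 1) (C : ChargeData N) (a : ℝ)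
    (ext : HiggsLattice.VecField P₁ k → HiggsLattice.VecField P₁ 0) (B : HiggsLattice.VecField P₁ (k + 1)) (ψ : ScalarField P₁ (k + 1) N) (A : HiggsLattice.VecField P₁ k)
    (φ : ScalarField P₁ k N) :
    stepExponent C a k ext B ψ A φ
      = -(a * (P₁.L : ℝ) ^ ((P₁.d : ℤ) - 2) / 2) * ∑ y : HiggsLattice.Site P₁ (k + 1), ‖toSite B y - linAvg (toSite A) y‖ ^ 2
        - a * (P₁.L : ℝ) ^ ((P₁.d : ℤ) - 2) / 2 * ∑ y : HiggsLattice.Site P₁ (k + 1), ‖ψ y - avgQ C (ext A) φ y‖ ^ 2 := by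
  unfold stepExponent
  rw [mesh_succ_of_unit h1, B1RT.prec_eq]

/-- The vector-field Gaussian term of (2.53) in coordinates, as printed: `|B(y) − (QA)(y)|² = Σ_μ (B_μ(y) − L^{−d}Σ_{x∈B(y)}
A_μ(x))²`. PROVED. [cite: Balaban1982Higgs2, (2.53) p.569] -/
theorem norm_sq_toSite_sub_linAvg (B : HiggsLattice.VecField P (k + 1)) (A : HiggsLattice.VecField P k) (y : HiggsLattice.Site P (k + 1)) :
    ‖toSite B y - linAvg (toSite A) y‖ ^ 2
      = ∑ μ : Fin P.d, (B ⟨y, μ⟩ - (((P.L : ℝ) ^ P.d)⁻¹) * ∑ x ∈ HiggsLattice.block y, A ⟨x, μ⟩) ^ 2 := by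
  rw [EuclideanSpace.real_norm_sq_eq]
  refine Finset.sum_congr rfl fun μ _ => ?_
  simp [toSite, linAvg, Finset.sum_apply, Finset.mul_sum]

/-- The constant factors produced by the two block kernels at level `k` (among print's *"Omitting the numerical factors"*):
`((κ/2π)^{d/2})^{|T^{(k)′}|} · ((κ/2π)^{N/2})^{|T^{(k)′}|}`, `κ = a(L·mesh_k)^{d−2}` — the product of the two kernel
normalisations `HiggsDoubleRT.kernelBound`. [cite: Balaban1982Higgs2, (2.53) p.569] -/
noncomputable def stepKernelConst (P : HiggsLattice.Params) (N k : ℕ) (a : ℝ) : ℝ :=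
  kernelBound P k P.d a * kernelBound P k N a

/-- The kernel constant is positive for `a > 0`. [cite: Balaban1982Higgs2, (2.53) p.569] -/
theorem stepKernelConst_pos (N k : ℕ) {a : ℝ} (ha : 0 < a) : 0 < stepKernelConst P N k a := by
  unfold stepKernelConst kernelBound
  have hκ : 0 < B1RT.prec a (P.mesh (k + 1)) P.d / (2 * π) := div_pos (prec_step_pos (P := P) (k := k) ha) (by positivity)
  exact mul_pos (pow_pos (Real.rpow_pos_of_pos hκ _) _) (pow_pos (Real.rpow_pos_of_pos hκ _) _)

end Display

/-! ## 5. PROVED: `T_{a,L}[T_{a,L,θ_kA^{(k)}}[summand_s]]` is `const · ∫dA∫dφ (2.53)-integrand_s` -/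

section DoubleRT

/-- The bracket is the sum of the two Gaussian exponents (regrouping). [cite: Balaban1982Higgs2, (2.53) p.569] -/
theorem stepExponent_eq_add (C : ChargeData N) (a : ℝ) (k : ℕ) (ext : HiggsLattice.VecField P k → HiggsLattice.VecField P 0)
    (B : HiggsLattice.VecField P (k + 1)) (ψ : ScalarField P (k + 1) N) (A : HiggsLattice.VecField P k) (φ : ScalarField P k N) :
    stepExponent C a k ext B ψ A φ
      = -(B1RT.prec a (P.mesh (k + 1)) P.d / 2) * ∑ y : HiggsLattice.Site P (k + 1), ‖toSite B y - linAvg (toSite A) y‖ ^ 2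
        + -(B1RT.prec a (P.mesh (k + 1)) P.d / 2) * ∑ y : HiggsLattice.Site P (k + 1), ‖ψ y - avgQ C (ext A) φ y‖ ^ 2 := by
  unfold stepExponent
  ring

/-- The vector-field kernel of `T^{L^kε}_{a,L}` is a constant times the exponential of the first Gaussian term of (2.53)
(plain block average: `Q(0) = Q`, `B2Eq21FirstStep.avgQ_zero`). [cite: Balaban1982Higgs2, (2.53) p.569] -/
theorem vecKernel_eq_const_mul_exp (a : ℝ) (B : HiggsLattice.VecField P (k + 1)) (A : HiggsLattice.VecField P k) :
    vecKernel a B A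
      = kernelBound P k P.d a
          * Real.exp (-(B1RT.prec a (P.mesh (k + 1)) P.d / 2)
              * ∑ y : HiggsLattice.Site P (k + 1), ‖toSite B y - linAvg (toSite A) y‖ ^ 2) := by
  rw [vecKernel_eq, blockKernel_eq_const_mul_exp, finrank_euclideanSpace_fin, avgQ_zero]
  rfl

/-- The scalar-field kernel of `T^{L^kε}_{a,L,Ã}` is a constant times the exponential of the second Gaussian term of (2.53).
[cite: Balaban1982Higgs2, (2.53) p.569] -/
theorem rtKernelStep_eq_const_mul_exp (C : ChargeData N) (a : ℝ) (E : HiggsLattice.VecField P 0) (ψ : ScalarField P (k + 1) N)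
    (φ : ScalarField P k N) :
    rtKernelStep C a E ψ φ
      = kernelBound P k N a
          * Real.exp (-(B1RT.prec a (P.mesh (k + 1)) P.d / 2) * ∑ y : HiggsLattice.Site P (k + 1), ‖ψ y - avgQ C E φ y‖ ^ 2) := by
  unfold rtKernelStep
  rw [blockKernel_eq_const_mul_exp, finrank_euclideanSpace_fin]
  rfl

/-- **p. 569 — from `T^{L^kε}_{a,L}[T^{L^kε}_{a,L,θ_kA^{(k),ε}}[·]]` applied to the (2.43) summand to the integrand of (2.53).**
On ANY lattice of the family, for any assignments `bg` (`A ↦ A^{(k)}`), `ext` (`A ↦ θ_kA^{(k)}`) and any sequence data: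
`T_{a,L}[T_{a,L,θ_kA^{(k)}}[summand_s]](B, ψ) = stepKernelConst · w_s · ∫dA ∫dφ stepIntegrand253_s(B, ψ; A, φ)` — the
kernels (I.2.5)–(I.2.6) of the two transformations contribute exactly the bracket of (2.53) and constant factors, the
three remaining factors are carried along.  PROVED (pointwise algebra of the integrands and linearity of the integral;
no convergence statement is used or made). [cite: Balaban1982Higgs2, (2.53) p.569] -/
theorem doubleRTk_summand243 (C : ChargeData N) (musq msq a : ℝ) (k : ℕ) (bg ext : HiggsLattice.VecField P k → HiggsLattice.VecField P 0)
    (S : SeqData P N k) (B : HiggsLattice.VecField P (k + 1)) (ψ : ScalarField P (k + 1) N) :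
    doubleRTk C a ext (summand243 C musq msq a k bg ext S) B ψ
      = stepKernelConst P N k a * S.w
          * ∫ A : HiggsLattice.VecField P k, ∫ φ : ScalarField P k N, stepIntegrand253 C musq msq a k bg ext S B ψ A φ := by
  rw [doubleRTk_eq, ← integral_const_mul]
  congr 1
  funext A
  rw [← integral_const_mul, ← integral_const_mul]
  congr 1
  funext φ
  rw [vecKernel_eq_const_mul_exp, rtKernelStep_eq_const_mul_exp]
  unfold stepIntegrand253 summand243 stepKernelConst
  rw [stepExponent_eq_add, Real.exp_add]
  ring

end DoubleRT

/-! ## 6. PROVED: the rescaling *"from the L^kε-lattice T^{(k)}_{L^kε} to 1-lattice T^{(k)}_1"* -/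

section Rescaling

variable {s : ℝ}

/-- The rescaling (1.22) of the zero vector field is zero. [cite: Balaban1982Higgs1, (1.22) p.607] -/
theorem rescaleVec_zero (hs : 0 < s) (j : ℕ) : rescaleVec hs (0 : HiggsLattice.VecField (P.scaleBy s hs) j) = 0 := by
  funext b
  simp [rescaleVec]

/-- The trivial coupling is its own rescaling (`e = 0`, p. 607 `e_s = es^{−(4−d)/2} = 0`). [cite: Balaban1982Higgs1, (1.23) p.607] -/
theorem zeroCharge_scaleBy (d : ℕ) (s : ℝ) : (zeroCharge d).scaleBy d s = zeroCharge d := by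
  simp [ChargeData.scaleBy, zeroCharge]

/-- The vector cut commutes with the rescaling (1.22) (same labels). [cite: Balaban1982Higgs2, (2.50) p.568] -/
theorem cutVec_rescaleVec (hs : 0 < s) (Λ : Finset (HiggsLattice.Site P k)) (A' : HiggsLattice.VecField (P.scaleBy s hs) k) :
    cutVec Λ (rescaleVec hs A') = rescaleVec hs (cutVec (P := P.scaleBy s hs) Λ A') := by
  funext b
  simp only [cutVec, rescaleVec]
  split_ifs <;> rename_i h₁ h₂ <;>
    first
      | rfl
      | exact (mul_zero _).symm
      | exact absurd h₁ h₂
      | exact absurd h₂ h₁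

/-- **The scalar product (I.1.5) under the rescaling (1.22)**: `⟨σf′, σg′⟩_{ε-weights} = s⁻²·⟨f′, g′⟩_{sε-weights}`
(`σ² = s^{d−2}` against the weight ratio `s^{−d}`). PROVED. [cite: Balaban1982Higgs1, (1.22) p.607] -/
theorem siteInner_rescaleScalar (hs : 0 < s) {j M : ℕ} (f' g' : ScalarField (P.scaleBy s hs) j M) :
    siteInner (P := P) (rescaleScalar hs f') (rescaleScalar hs g')
      = s⁻¹ ^ 2 * siteInner (P := P.scaleBy s hs) f' g' := by
  unfold siteInner
  simp only [rescaleScalar, mesh_scaleBy, inner_smul_left, inner_smul_right, conj_trivial, Finset.mul_sum]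
  refine Finset.sum_congr rfl fun x _ => ?_
  have hσ : s ^ (((P.d : ℝ) - 2) / 2) * s ^ (((P.d : ℝ) - 2) / 2) = s ^ P.d * s⁻¹ ^ 2 := by
    rw [← Real.rpow_add hs, show ((P.d : ℝ) - 2) / 2 + ((P.d : ℝ) - 2) / 2 = (P.d : ℝ) - 2 by ring,
      Real.rpow_sub hs, Real.rpow_natCast, Real.rpow_two, inv_pow, div_eq_mul_inv]
  rw [show (P.scaleBy s hs).d = P.d from rfl, mul_pow]
  calc P.mesh j ^ P.d * (s ^ (((P.d : ℝ) - 2) / 2) * (s ^ (((P.d : ℝ) - 2) / 2) * inner ℝ (f' x) (g' x)))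
      = P.mesh j ^ P.d * (s ^ (((P.d : ℝ) - 2) / 2) * s ^ (((P.d : ℝ) - 2) / 2)) * inner ℝ (f' x) (g' x) := by ring
    _ = P.mesh j ^ P.d * (s ^ P.d * s⁻¹ ^ 2) * inner ℝ (f' x) (g' x) := by rw [hσ]
    _ = s⁻¹ ^ 2 * (s ^ P.d * P.mesh j ^ P.d * inner ℝ (f' x) (g' x)) := by ring

/-- **The basic quadratic form `⟨u, Δ^{(j),L^jε}(Ω, Ã)u⟩` is invariant under the canonical rescaling (1.22)** with the mass
`m² ↦ m²s⁻²` and the charge `e ↦ e_s` (p. 607): `⟨σu′, Δ^{(j),L^jε}(Ω, σÃ′; m²)(σu′)⟩_ε = ⟨u′, Δ^{(j),L^jsε}(Ω, Ã′; m²s⁻²)u′⟩_{sε}`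
— r14's `B1Eq231Rescale.deltaKA_rescale` (`Δ(σu′) = s²σΔ′u′`) against `siteInner_rescaleScalar`; `m² > 0`, `a > 0`,
`L > 1`. PROVED. [cite: Balaban1982Higgs1, (2.21) p.610, (2.31) p.611] -/
theorem quadForm_deltaKA_rescale (hs : 0 < s) (C : ChargeData N) (Ω : Finset (HiggsLattice.Site P 0))
    (A' : HiggsLattice.VecField (P.scaleBy s hs) 0) {msq a : ℝ} (hmsq : 0 < msq) (ha : 0 < a) (hL : 1 < (P.L : ℝ)) (j : ℕ)
    (u' : ScalarField (P.scaleBy s hs) j N) :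
    siteInner (P := P) (rescaleScalar hs u') (deltaKA C Ω (rescaleVec hs A') msq a j (rescaleScalar hs u'))
      = siteInner (P := P.scaleBy s hs) u'
          (deltaKA (P := P.scaleBy s hs) (C.scaleBy P.d s) Ω A' (msq * s⁻¹ ^ 2) a j u') := by
  rw [deltaKA_rescale hs C Ω A' hmsq a j (level_cases ha hL j) u', siteInner_smul_right, siteInner_rescaleScalar hs]
  have hs0 : s ≠ 0 := hs.ne'
  field_simp

/-- **The basic Gaussian factor of (2.49)/(2.53) under the rescaling**: with the masses `μ₀² ↦ μ₀²s⁻²`, `m² ↦ m²s⁻²`, the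
charge `e ↦ e_s` and the background rescaled (`A^{(k),ε} = σA^{(k)′}`),
`[factor]^{ε}(σA^{(k)′}; σA′, σφ′) = [factor]^{sε}(A^{(k)′}; A′, φ′)` — both quadratic forms are scale-invariant (the cuts
commute with `σ·`; vector part at the trivial coupling, `zeroCharge_scaleBy`). PROVED. [cite: Balaban1982Higgs2, (2.49) p.568, (2.53) p.569] -/
theorem gauss249_rescale (hs : 0 < s) (C : ChargeData N) {musq msq a : ℝ} (hmusq : 0 < musq) (hmsq : 0 < msq)
    (ha : 0 < a) (hL : 1 < (P.L : ℝ)) (k : ℕ) (Ω : Finset (HiggsLattice.Site P 0))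
    (Λ₆ : Finset (HiggsLattice.Site P k)) (Ak' : HiggsLattice.VecField (P.scaleBy s hs) 0)
    (A' : HiggsLattice.VecField (P.scaleBy s hs) k) (φ' : ScalarField (P.scaleBy s hs) k N) :
    gauss249 (P := P) C musq msq a k Ω Λ₆ (rescaleVec hs Ak') (rescaleVec hs A') (rescaleScalar hs φ')
      = gauss249 (P := P.scaleBy s hs) (C.scaleBy P.d s) (musq * s⁻¹ ^ 2) (msq * s⁻¹ ^ 2) a k Ω Λ₆ Ak' A' φ' := by
  have hV : gaussVec (P := P) musq a k Λ₆ (rescaleVec hs A')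
      = gaussVec (P := P.scaleBy s hs) (musq * s⁻¹ ^ 2) a k Λ₆ A' := by
    unfold gaussVec
    rw [toSite_rescaleVec hs A', cutTo_rescaleScalar hs, ← rescaleVec_zero hs 0,
      quadForm_deltaKA_rescale hs (zeroCharge P.d) Finset.univ 0 hmusq ha hL k, zeroCharge_scaleBy]
    rfl
  have hS : gaussScalar (P := P) C msq a k Ω Λ₆ (rescaleVec hs Ak') (rescaleScalar hs φ')
      = gaussScalar (P := P.scaleBy s hs) (C.scaleBy P.d s) (msq * s⁻¹ ^ 2) a k Ω Λ₆ Ak' φ' := by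
    unfold gaussScalar
    rw [cutTo_rescaleScalar hs, quadForm_deltaKA_rescale hs C Ω Ak' hmsq ha hL k]
  unfold gauss249
  rw [hV, hS]

/-- **`θ_kA^{(k)}` under the rescaling**: if the background assignment is covariant (`A^{(k),ε}[σA′] = σ·A^{(k)′}[A′]`, the
rescaling *"of the propagators"*, hypothesis `hbg`; for the cut-off-free (I.3.29) field this is
`HiggsBackgroundRescale.bgVec_rescale`), then so is `θ_kA^{(k)}` (`θ_k` is a fixed function of the labels). PROVED.
[cite: Balaban1982Higgs2, (2.53) p.569] -/
theorem thetaMul_rescale (hs : 0 < s) (θ : HiggsLattice.Site P 0 → ℝ) {bg : HiggsLattice.VecField P k → HiggsLattice.VecField P 0}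
    {bg' : HiggsLattice.VecField (P.scaleBy s hs) k → HiggsLattice.VecField (P.scaleBy s hs) 0}
    (hbg : ∀ A', bg (rescaleVec hs A') = rescaleVec hs (bg' A')) (A' : HiggsLattice.VecField (P.scaleBy s hs) k) :
    thetaMul θ bg (rescaleVec hs A') = rescaleVec hs (thetaMul (P := P.scaleBy s hs) θ bg' A') := by
  funext b
  rw [thetaMul_apply, hbg A']
  simp only [rescaleVec, thetaMul_apply]
  ring

/-- The data of a sequence READ ON THE RESCALED FAMILY: the same regions (same labels), the densities `ρ′^{(k)}` and `𝒫^{(k)}`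
pulled back along (1.22) — print's convention of dropping the superscript `L^kε` after the rescaling (`ρ′^{(k),L^kε}` ↦
`ρ′^{(k)}`, `𝒫^{(k),L^kε}` ↦ `𝒫^{(k)}` in (2.53)) —, the same numerical factor. [cite: Balaban1982Higgs2, (2.53) p.569] -/
noncomputable def SeqData.rescale (hs : 0 < s) (S : SeqData P N k) : SeqData (P.scaleBy s hs) N k where
  B2 := S.B2
  R6 := S.R6
  R7 := S.R7
  rhoP A' E' φ' := S.rhoP (rescaleVec hs A') (rescaleVec hs E') (rescaleScalar hs φ')
  calP E' φ' := S.calP (rescaleVec hs E') (rescaleScalar hs φ')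
  w := S.w

/-- **The (2.43) summand pulled back along the rescaling (1.22) is the (2.43) summand of the rescaled family** (masses
`μ₀²s⁻²`, `m²s⁻²`, charge `e_s`, background and external field rescaled, `ρ′`/`𝒫` pulled back) — given the covariance of
`A ↦ A^{(k)}` (`hbg`) and of `A ↦ θ_kA^{(k)}` (`hext`; for `ext = thetaMul θ bg` it follows from `hbg`, `thetaMul_rescale`).
PROVED. [cite: Balaban1982Higgs2, (2.43) p.566, (2.53) p.569] -/
theorem summand243_rescale (hs : 0 < s) (C : ChargeData N) {musq msq a : ℝ} (hmusq : 0 < musq) (hmsq : 0 < msq)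
    (ha : 0 < a) (hL : 1 < (P.L : ℝ)) (k : ℕ) {bg ext : HiggsLattice.VecField P k → HiggsLattice.VecField P 0}
    {bg' ext' : HiggsLattice.VecField (P.scaleBy s hs) k → HiggsLattice.VecField (P.scaleBy s hs) 0}
    (hbg : ∀ A', bg (rescaleVec hs A') = rescaleVec hs (bg' A'))
    (hext : ∀ A', ext (rescaleVec hs A') = rescaleVec hs (ext' A')) (S : SeqData P N k)
    (A' : HiggsLattice.VecField (P.scaleBy s hs) k) (φ' : ScalarField (P.scaleBy s hs) k N) :
    summand243 (P := P) C musq msq a k bg ext S (rescaleVec hs A') (rescaleScalar hs φ')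
      = summand243 (P := P.scaleBy s hs) (C.scaleBy P.d s) (musq * s⁻¹ ^ 2) (msq * s⁻¹ ^ 2) a k bg' ext'
          (S.rescale hs) A' φ' := by
  unfold summand243
  rw [hext A', hbg A', cutVec_rescaleVec hs, cutTo_rescaleScalar hs,
    gauss249_rescale hs C hmusq hmsq ha hL k S.B2 S.R6 (bg' A') A' φ']
  rfl

/-- **p. 569: "At first we rescale it from the L^kε-lattice T^{(k)}_{L^kε} to 1-lattice T^{(k)}_1. Omitting the numerical
factors, we get the integral (2.53)"** — typed reading, for a general factor `s > 0` (in print `s = (L^kε)⁻¹`): the double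
transformation `T^{L^kε}_{a,L}[T^{L^kε}_{a,L,θ_kA^{(k),ε}}[summand_s]]` of the `s`-th term of (2.43), evaluated at the
rescalings (1.22) of block fields `B′, ψ′` of the `sε`-family, equals `(rescaleFactor · stepKernelConst · w_s)` times
`∫dA′∫dφ′ stepIntegrand253_s(B′, ψ′; A′, φ′)` over the fields of the `sε`-family with the rescaled constants and the
pulled-back data — which at `s = (L^kε)⁻¹` is the `s`-th term of (2.53) (`stepExponent_unit`, `B1Eq338Rescaling.unit_mesh_k`)
with its omitted numerical factor explicit.  PROVED: `HiggsDoubleRTRescale.doubleRTk_rescale` + `summand243_rescale` +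
`doubleRTk_summand243`. [cite: Balaban1982Higgs2, (2.53) p.569] -/
theorem doubleRTk_summand243_rescale (hs : 0 < s) (C : ChargeData N) {musq msq a : ℝ} (hmusq : 0 < musq)
    (hmsq : 0 < msq) (ha : 0 < a) (hL : 1 < (P.L : ℝ)) (k : ℕ) {bg ext : HiggsLattice.VecField P k → HiggsLattice.VecField P 0}
    {bg' ext' : HiggsLattice.VecField (P.scaleBy s hs) k → HiggsLattice.VecField (P.scaleBy s hs) 0}
    (hbg : ∀ A', bg (rescaleVec hs A') = rescaleVec hs (bg' A'))
    (hext : ∀ A', ext (rescaleVec hs A') = rescaleVec hs (ext' A')) (S : SeqData P N k)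
    (B' : HiggsLattice.VecField (P.scaleBy s hs) (k + 1)) (ψ' : ScalarField (P.scaleBy s hs) (k + 1) N) :
    doubleRTk C a ext (summand243 C musq msq a k bg ext S) (rescaleVec hs B') (rescaleScalar hs ψ')
      = rescaleFactor P N k s * (stepKernelConst (P.scaleBy s hs) N k a * S.w)
          * ∫ A' : HiggsLattice.VecField (P.scaleBy s hs) k, ∫ φ' : ScalarField (P.scaleBy s hs) k N,
              stepIntegrand253 (P := P.scaleBy s hs) (C.scaleBy P.d s) (musq * s⁻¹ ^ 2) (msq * s⁻¹ ^ 2) a k bg' ext'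
                (S.rescale hs) B' ψ' A' φ' := by
  rw [doubleRTk_rescale hs C ha.le hext (summand243 C musq msq a k bg ext S) B' ψ']
  have hρ : (fun A' φ' => summand243 (P := P) C musq msq a k bg ext S (rescaleVec hs A') (rescaleScalar hs φ'))
      = summand243 (P := P.scaleBy s hs) (C.scaleBy P.d s) (musq * s⁻¹ ^ 2) (msq * s⁻¹ ^ 2) a k bg' ext'
          (S.rescale hs) := by
    funext A' φ'
    exact summand243_rescale hs C hmusq hmsq ha hL k hbg hext S A' φ'
  have hw : (S.rescale hs).w = S.w := rfl
  rw [hρ, doubleRTk_summand243, hw]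
  ring

/-- The unit lattice of p. 569: at `s = (L^kε)⁻¹` (`B1Eq338Rescaling.unitScale`) the rescaled family has `mesh_k = 1`, so the
right side of `doubleRTk_summand243_rescale` carries the bracket with `aL^{d−2}` (`stepExponent_unit`) and the masses
`μ₀²(L^kε)²`, `m²(L^kε)²` ((I.2.22)): the constants of (2.53). PROVED. [cite: Balaban1982Higgs2, (2.53) p.569] -/
theorem doubleRTk_summand243_unit (C : ChargeData N) {musq msq a : ℝ} (hmusq : 0 < musq) (hmsq : 0 < msq)
    (ha : 0 < a) (hL : 1 < (P.L : ℝ)) (k : ℕ) {bg ext : HiggsLattice.VecField P k → HiggsLattice.VecField P 0}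
    {bg' ext' : HiggsLattice.VecField (P.scaleBy (B1Eq338Rescaling.unitScale P k) (B1Eq338Rescaling.unitScale_pos P k)) k →
      HiggsLattice.VecField (P.scaleBy (B1Eq338Rescaling.unitScale P k) (B1Eq338Rescaling.unitScale_pos P k)) 0}
    (hbg : ∀ A', bg (rescaleVec (B1Eq338Rescaling.unitScale_pos P k) A')
      = rescaleVec (B1Eq338Rescaling.unitScale_pos P k) (bg' A'))
    (hext : ∀ A', ext (rescaleVec (B1Eq338Rescaling.unitScale_pos P k) A')
      = rescaleVec (B1Eq338Rescaling.unitScale_pos P k) (ext' A'))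
    (S : SeqData P N k)
    (B' : HiggsLattice.VecField (P.scaleBy (B1Eq338Rescaling.unitScale P k) (B1Eq338Rescaling.unitScale_pos P k)) (k + 1))
    (ψ' : ScalarField (P.scaleBy (B1Eq338Rescaling.unitScale P k) (B1Eq338Rescaling.unitScale_pos P k)) (k + 1) N) :
    doubleRTk C a ext (summand243 C musq msq a k bg ext S) (rescaleVec (B1Eq338Rescaling.unitScale_pos P k) B')
        (rescaleScalar (B1Eq338Rescaling.unitScale_pos P k) ψ')
      = rescaleFactor P N k (B1Eq338Rescaling.unitScale P k)
          * (stepKernelConst (P.scaleBy (B1Eq338Rescaling.unitScale P k) (B1Eq338Rescaling.unitScale_pos P k)) N k a * S.w)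
          * ∫ A' : HiggsLattice.VecField (P.scaleBy (B1Eq338Rescaling.unitScale P k) (B1Eq338Rescaling.unitScale_pos P k)) k,
              ∫ φ' : ScalarField (P.scaleBy (B1Eq338Rescaling.unitScale P k) (B1Eq338Rescaling.unitScale_pos P k)) k N,
                stepIntegrand253 (C.scaleBy P.d (B1Eq338Rescaling.unitScale P k)) (musq * (P.mesh k) ^ 2)
                  (msq * (P.mesh k) ^ 2) a k bg' ext' (S.rescale (B1Eq338Rescaling.unitScale_pos P k)) B' ψ' A' φ'
        ∧ (P.scaleBy (B1Eq338Rescaling.unitScale P k) (B1Eq338Rescaling.unitScale_pos P k)).mesh k = 1 := by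
  refine ⟨?_, B1Eq338Rescaling.unit_mesh_k P k⟩
  have hm : (B1Eq338Rescaling.unitScale P k)⁻¹ ^ 2 = P.mesh k ^ 2 := by
    rw [B1Eq338Rescaling.unitScale, inv_inv]
  rw [doubleRTk_summand243_rescale (B1Eq338Rescaling.unitScale_pos P k) C hmusq hmsq ha hL k hbg hext S B' ψ', hm]

/-- **(2.53) ITSELF as the image of the (2.43) integrand**: on the rescaled family (`s = (L^kε)⁻¹` in print) the display
`display253` for a finite family of admissible sequences (data pulled back, constants rescaled) IS the sum over the sequences
of the double transformations of the (2.43) summands at the rescaled block fields, each divided by its numerical factor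
`rescaleFactor · stepKernelConst · w_s` (print: *"Omitting the numerical factors, we get the integral (2.53)"*); `w_s ≠ 0`.
PROVED from `doubleRTk_summand243_rescale`. [cite: Balaban1982Higgs2, (2.53) p.569] -/
theorem display253_eq_sum_doubleRTk (hs : 0 < s) (C : ChargeData N) {musq msq a : ℝ} (hmusq : 0 < musq)
    (hmsq : 0 < msq) (ha : 0 < a) (hL : 1 < (P.L : ℝ)) (k : ℕ) {bg ext : HiggsLattice.VecField P k → HiggsLattice.VecField P 0}
    {bg' ext' : HiggsLattice.VecField (P.scaleBy s hs) k → HiggsLattice.VecField (P.scaleBy s hs) 0}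
    (hbg : ∀ A', bg (rescaleVec hs A') = rescaleVec hs (bg' A'))
    (hext : ∀ A', ext (rescaleVec hs A') = rescaleVec hs (ext' A')) {ι : Type*} (𝓢 : Finset ι) (S : ι → SeqData P N k)
    (hw : ∀ i ∈ 𝓢, (S i).w ≠ 0) (B' : HiggsLattice.VecField (P.scaleBy s hs) (k + 1))
    (ψ' : ScalarField (P.scaleBy s hs) (k + 1) N) :
    display253 𝓢 (C.scaleBy P.d s) (musq * s⁻¹ ^ 2) (msq * s⁻¹ ^ 2) a k bg' ext' (fun i => (S i).rescale hs) B' ψ'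
      = ∑ i ∈ 𝓢, (rescaleFactor P N k s * (stepKernelConst (P.scaleBy s hs) N k a * (S i).w))⁻¹
          * doubleRTk C a ext (summand243 C musq msq a k bg ext (S i)) (rescaleVec hs B') (rescaleScalar hs ψ') := by
  unfold display253
  refine Finset.sum_congr rfl fun i hi => ?_
  have hc : rescaleFactor P N k s * (stepKernelConst (P.scaleBy s hs) N k a * (S i).w) ≠ 0 :=
    mul_ne_zero (rescaleFactor_pos P N k hs).ne'
      (mul_ne_zero (stepKernelConst_pos (P := P.scaleBy s hs) N k ha).ne' (hw i hi))
  rw [doubleRTk_summand243_rescale hs C hmusq hmsq ha hL k hbg hext (S i) B' ψ', inv_mul_cancel_left₀ hc]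

/-- **Print's instance up to the cut-off `ζ^{(k)}`** — both covariance hypotheses DISCHARGED: with `A^{(k),ε}` the cut-off-free
background field (I.3.29) `a_k(L^kε)^{−2}G^ε_kQ^*_kA` = `B1Eq31Concrete.bgVec μ₀² a k` (i.e. (2.44) at `ζ ≡ 1`,
`B2StepK.bg244_one`) and `θ_kA^{(k),ε} = thetaMul θ (A ↦ A^{(k),ε})` for any site function `θ` (print's `θ_k`), the rescaling
identity `doubleRTk_summand243_rescale` holds outright — `hbg` is the typer's `HiggsBackgroundRescale.bgVec_rescale` (the
rescaling *"of the propagators"*, vector mass `μ₀² ↦ μ₀²s⁻²`), `hext` is `thetaMul_rescale`.  (With the cut-off `ζ^{(k)}` of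
(2.44) the corresponding covariance is not in the tree — HONEST SCOPE (a).) [cite: Balaban1982Higgs2, (2.53) p.569] -/
theorem doubleRTk_summand243_rescale_bgVec (hs : 0 < s) (C : ChargeData N) {musq msq a : ℝ} (hmusq : 0 < musq)
    (hmsq : 0 < msq) (ha : 0 < a) (hL : 1 < (P.L : ℝ)) (k : ℕ) (θ : HiggsLattice.Site P 0 → ℝ) (S : SeqData P N k)
    (B' : HiggsLattice.VecField (P.scaleBy s hs) (k + 1)) (ψ' : ScalarField (P.scaleBy s hs) (k + 1) N) :
    doubleRTk C a (thetaMul θ fun A => B1Eq31Concrete.bgVec musq a k A)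
        (summand243 C musq msq a k (fun A => B1Eq31Concrete.bgVec musq a k A)
          (thetaMul θ fun A => B1Eq31Concrete.bgVec musq a k A) S)
        (rescaleVec hs B') (rescaleScalar hs ψ')
      = rescaleFactor P N k s * (stepKernelConst (P.scaleBy s hs) N k a * S.w)
          * ∫ A' : HiggsLattice.VecField (P.scaleBy s hs) k, ∫ φ' : ScalarField (P.scaleBy s hs) k N,
              stepIntegrand253 (P := P.scaleBy s hs) (C.scaleBy P.d s) (musq * s⁻¹ ^ 2) (msq * s⁻¹ ^ 2) a k
                (fun A' => B1Eq31Concrete.bgVec (P := P.scaleBy s hs) (musq * s⁻¹ ^ 2) a k A')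
                (thetaMul θ fun A' => B1Eq31Concrete.bgVec (P := P.scaleBy s hs) (musq * s⁻¹ ^ 2) a k A')
                (S.rescale hs) B' ψ' A' φ' :=
  doubleRTk_summand243_rescale hs C hmusq hmsq ha hL k
    (bg := fun A => B1Eq31Concrete.bgVec musq a k A)
    (bg' := fun A' => B1Eq31Concrete.bgVec (P := P.scaleBy s hs) (musq * s⁻¹ ^ 2) a k A')
    (fun A' => HiggsBackgroundRescale.bgVec_rescale hs hmusq ha.le k A')
    (thetaMul_rescale hs θ (bg := fun A => B1Eq31Concrete.bgVec musq a k A)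
      (bg' := fun A' => B1Eq31Concrete.bgVec (P := P.scaleBy s hs) (musq * s⁻¹ ^ 2) a k A')
      fun A' => HiggsBackgroundRescale.bgVec_rescale hs hmusq ha.le k A')
    S B' ψ'

end Rescaling

/-! ## 7. (2.54): `A^{(k)} = a_kζ^{(k)}G_kQ^*_kA` — (2.44) after the rescaling -/

section Eq254

/-- **(2.54)** p. 569, verbatim: *"Let us recall the formula for A^{(k)} after the rescaling A^{(k)} = a_kζ^{(k)}G_kQ^*_kA, (2.54)"*
— the cut-off background field (2.44) `A^{(k),ε} = a_k(L^kε)^{−2}ζ^{(k)}G^ε_kQ^*_kA` (r14's `B2StepK.bg244 ak ℓ ζ GQs A`, the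
entrywise cut-off `ζ ⊙` of the kernel of `G_kQ^*_k`) read on the unit lattice, `ℓ = L^kε ↦ 1`: the factor `(L^kε)^{−2}`
disappears and `G^ε_k` becomes the rescaled `G_k` of (I.2.22) (entering through `GQs`).  PROVED (unfolding; the same reading
as p23's `B2Eq289Decomposition.Ak_eq_bg244`). [cite: Balaban1982Higgs2, (2.54) p.569] -/
theorem eq254 {X Y : Type} [Fintype Y] (ak : ℝ) (ζ GQs : Matrix X Y ℝ) (A : Y → ℝ) :
    B2StepK.bg244 ak 1 ζ GQs A = ak • ((ζ ⊙ GQs) *ᵥ A) := by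
  unfold B2StepK.bg244
  rw [one_pow, inv_one, mul_one]

end Eq254

end Literature.MathematicalPhysics.QuantumFieldTheory.Balaban1983to89.B2Eq253StepIntegral
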